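import Summits.Schanuel.Schanuel.Theorems.DiophantineDichotomyApproximationPropertyDefs

/-!
# Vocabulary of the stub plan for `CycleAPIAt3 : CycleAPIAt 3` (crux `ApproximationProperty`, stmt-Schanuel-6117)

Route `DiophantineDichotomy` (sub-problem `Schanuel/Schanuel`), crux
`Summit.Schanuel.Schanuel.Theses.DiophantineDichotomy.ApproximationProperty`, line
`orbit-interpolation-determinant` (vocabulary `DiophantineDichotomyApproximationPropertyDefs.lean`),
registered stub `CycleAPIAt3 : CycleAPIAt 3` (the 0-cycle approximation property with interpolation
control in `ℙ³`). This is the **definitions module of the stub plan**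
`Cruxes/ApproximationProperty/STUB-PLAN-CycleAPIAt3.md` (critic
`planner-scrit-stmt-Schanuel-6117-CycleAPIAt3-0`, typed helpers `STUB_PLAN_CycleAPIAt3.lean`,
2026-08-16): it carries, sorry-free, the INTERMEDIATE STATEMENTS of the plan so that the helper files
`Theorems/DiophantineDichotomyApproximationPropertyCycleAPIAt3*.lean` (each proving a registered
sub-goal of the crux item BY NAME, `--supports stmt-Schanuel-6117`) and the lead's skeleton share
ONE copy of every object — the same design as `DiophantineDichotomyApproximationPropertyDefs.lean`.

The plan (§2 of the `.md`): run the clause-free `t = 3` descent at a constant `c_d` and certify at a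
larger constant `c_f` (every occurrence of `c` in `CycleAPIAt` is monotone); case-split the enriched
descent output — a prime orbit `𝔭 ⊇ 𝔮₂ + (T)` on the selected prime curve `𝔮₂ ∋ Q, P` of the
complete intersection `(Q, P)`: (G0) short orbits have the clause automatically
(`rankOne_interpolation_of_ideg_le`, landed); (G1) orbits minimal over `(Q, P, T)` are isolated
points of the triple intersection (`IsolatedPointClause3`, Chardin–Philippon); (B) otherwise the
orbit lies on a SATELLITE `𝔮'` — another component of the c.i. curve containing `T`
(`satellite_dichotomy`, landed as a registered sub-goal): satellites of degree `≤ δ⋆` are RESTARTED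
(`SatelliteRestart δ⋆`, composed from `OrbitFloor`, `SatelliteHeight[Line]`, `ContainerRestart`),
far satellites are the typed open residual (`NoFarBadSatellite δ⋆`).

Contents (nothing is asserted; every `def … : Prop` is a statement to be proved by a registered
sub-goal, or an explicit hypothesis of the assembly):
* `CycleAP3Datum`, `CycleAP3Data` (P1) — the clause-free descent WITH its construction data;
* `OrbitFloor` (P2), `SatelliteHeightLine` (P3), `SatelliteHeight` (P3′), `ContainerRestart` (P4);
* `SatelliteRestart δ⋆` (P7), `NoFarBadSatellite δ⋆` (P6, the residual, stated on the full datum);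
* `IsolatedPointClause3` (P5 specialised to three forms of `ℚ[x₀, …, x₃]`: the interpolation
  statement the good case consumes; to be discharged from Chardin–Philippon, *Régularité et
  interpolation*, J. Algebraic Geom. 8 (1999) 471–481, with the erratum ibid. 11 (2002) 599–600,
  once the text is held — acq-06248).

Differences from the critic's typed file, all on the safe side for the provers of P1/P6: the datum
keeps the degree/height/value bounds of the selected curve `𝔮₂` and the Bézout bound
`deg 𝔭 ≤ deg 𝔮₂ · deg T` (all returned by the landed `small_prime_of_cut`), allows `deg T ≤ 5Δ`,
and `NoFarBadSatellite` receives the whole datum and the satellite's provenance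
(`𝔮' ∈ (Q, P).minimalPrimes`, `T ∈ 𝔮'`).

Sources: NesterenkoPhilippon2001 (LNM 1752) Ch. 3 §4, Ch. 4 §4 p. 61 (AP1/AP2); Philippon2000
(doi:10.1006/jnth.1999.2461); ChardinPhilippon1999 (J. Algebraic Geom. 8); LaurentRoy1999.
-/

noncomputable section

-- `Summit.Schanuel.Schanuel.…` is the mandated summit/sub-problem namespace (single-conjunct summit), hence:
set_option linter.dupNamespace false

attribute [local instance] MvPolynomial.gradedAlgebra

namespace Summit.Schanuel.Schanuel.Cruxes.ApproximationProperty.OrbitInterpolationDeterminant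

open Literature.NumberTheory.Transcendental.Nesterenko MvPolynomial
open scoped BigOperators

/-! ## P1: the clause-free `t = 3` descent with its construction data -/

/-- **One datum of the clause-free `t = 3` descent at `ω ∈ ℂ³`, scale `(Δ, Y)`, constant `c`**:
the small prime surface `Q` (`deg a ≤ Δ`, `(Q)` prime), the second cut `P ∉ (Q)` (`deg b ≤ 2Δ`),
the selected prime curve `𝔮₂ ∋ Q, P` (rank `2`, `deg ≤ 2Δ²`, `h ≤ cΔY`,
`|𝔮₂(1:ω)| ≤ exp(−(Δ/c)(Δ h(𝔮₂) + Y deg 𝔮₂))`), the third cut `T ∉ 𝔮₂` (`1 ≤ deg τ ≤ 5Δ`), and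
the selected prime orbit `𝔭 ⊇ 𝔮₂ + (T)` (rank `1`, `deg 𝔭 ≤ deg 𝔮₂ · τ`) with the `CycleAPIAt 3`
budgets and accuracy at constant `c`: `deg 𝔭 ≤ (cΔ)³`, `h(𝔭) ≤ cYΔ²`,
`|𝔭(1:ω)| ≤ exp(−(Δ h(𝔭) + Y deg 𝔭)/c)`. (The lead's `smallPrimeCurve3_of` and
`small_prime_of_cut` return exactly these data; stub plan P1.) -/
def CycleAP3Datum (ω : Fin 3 → ℂ) (c Δ Y : ℝ) (Q : Rx 3) (a : ℕ) (P : Rx 3) (b : ℕ)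
    (𝔮₂ : Ideal (Rx 3)) (T : Rx 3) (τ : ℕ) (𝔭 : Ideal (Rx 3)) : Prop :=
  Q ≠ 0 ∧ Q.IsHomogeneous a ∧ 1 ≤ a ∧ (a : ℝ) ≤ Δ ∧ (Ideal.span {Q}).IsPrime ∧
  P.IsHomogeneous b ∧ 1 ≤ b ∧ (b : ℝ) ≤ 2 * Δ ∧ P ∉ Ideal.span {Q} ∧
  𝔮₂.IsPrime ∧ 𝔮₂.IsHomogeneous (homogeneousSubmodule (Fin (3 + 1)) ℚ) ∧
  IsUnmixedOfRank 𝔮₂ 2 ∧ Q ∈ 𝔮₂ ∧ P ∈ 𝔮₂ ∧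
  (ideg 𝔮₂ 2 : ℝ) ≤ 2 * Δ ^ 2 ∧ iheight 𝔮₂ 2 ≤ c * Δ * Y ∧
  iabs 𝔮₂ 2 (Fin.cons 1 ω) ≤ Real.exp (-(Δ / c * (Δ * iheight 𝔮₂ 2 + Y * ideg 𝔮₂ 2))) ∧
  T.IsHomogeneous τ ∧ 1 ≤ τ ∧ (τ : ℝ) ≤ 5 * Δ ∧ T ∉ 𝔮₂ ∧
  𝔭.IsPrime ∧ 𝔭.IsHomogeneous (homogeneousSubmodule (Fin (3 + 1)) ℚ) ∧
  IsUnmixedOfRank 𝔭 1 ∧ 𝔮₂ ≤ 𝔭 ∧ T ∈ 𝔭 ∧ ideg 𝔭 1 ≤ ideg 𝔮₂ 2 * τ ∧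
  (ideg 𝔭 1 : ℝ) ≤ (c * Δ) ^ 3 ∧ iheight 𝔭 1 ≤ c * Y * Δ ^ 2 ∧
  iabs 𝔭 1 (Fin.cons 1 ω) ≤ Real.exp (-((Δ * iheight 𝔭 1 + Y * ideg 𝔭 1) / c))

/-- **P1 `CycleAP3Data`** — the clause-free `t = 3` descent (Philippon's AP1 with `d' = 0` in
`ℙ³`, prime output) WITH its construction data kept: for every `ω ∈ ℂ³` there is `c ≥ 1` such
that every scale `Y ≥ Δ ≥ c` carries a `CycleAP3Datum`. (The lead's `smallPrimeCurve3_of` →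
`cycleAP3Prime_of_curve`, registered, with the data returned instead of discarded; LNM 1752
Ch. 4 §4 p. 61, Philippon2000.) -/
def CycleAP3Data : Prop :=
  ∀ ω : Fin 3 → ℂ, ∃ c : ℝ, 1 ≤ c ∧ ∀ Δ Y : ℝ, c ≤ Δ → Δ ≤ Y →
    ∃ (Q : Rx 3) (a : ℕ) (P : Rx 3) (b : ℕ) (𝔮₂ : Ideal (Rx 3)) (T : Rx 3) (τ : ℕ)
      (𝔭 : Ideal (Rx 3)), CycleAP3Datum ω c Δ Y Q a P b 𝔮₂ T τ 𝔭

/-! ## P2: the orbit floor -/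

/-- **P2 `OrbitFloor`** — a prime orbit `𝔭` (rank `1`, `D = deg 𝔭`, `h = h(𝔭)`) lying on a
`ℚ`-curve `V(𝔮)` (`𝔮 ≤ 𝔭`, `𝔮` prime of rank `2`, `δₛ = deg 𝔮`) all of whose points stay at
projective distance `≥ e^{−L}` (`L ≥ 1`) from `ω̄ = (1 : ω)` cannot be much smaller at `ω̄` than
that allows: `log (1/|𝔭(ω̄)|) ≤ C · (δₛ L + h + D log(D+2) + √(D (h + D + δₛ log(D+2)) L))` with
`C = C(ω)`. No `D² log D` term. (Coordinate chart at `i = argmax |ω̄ᵢ|`, `y = b_j/b_i` with a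
norm form outside `𝔮` so that the fibres of `σ ↦ σ(y)` have size `[K:ℚ(y)] ≤ δₛ`; the landed
`OrbitClusterBound` at `t = 1` for `ℚ(y)`; the landed `ZeroDimDictionary` (C), (D); layer-cake
summation. Stub plan P2, k1 H3 ⊕ k2 H2/H3.) -/
def OrbitFloor : Prop :=
  ∀ ω : Fin 3 → ℂ, ∃ C : ℝ, 0 < C ∧
    ∀ (𝔭 𝔮 : Ideal (Rx 3)) (L : ℝ), 𝔭.IsPrime → 𝔭.IsHomogeneous (homogeneousSubmodule (Fin (3 + 1)) ℚ) →
      IsUnmixedOfRank 𝔭 1 → 𝔮.IsPrime → 𝔮.IsHomogeneous (homogeneousSubmodule (Fin (3 + 1)) ℚ) →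
      IsUnmixedOfRank 𝔮 2 → 𝔮 ≤ 𝔭 → 1 ≤ L →
      (∀ β ∈ projZeros 𝔭, Real.exp (-L) ≤ projDist (Fin.cons 1 ω) β) →
      Real.log (1 / iabs 𝔭 1 (Fin.cons 1 ω)) ≤
        C * ((ideg 𝔮 2 : ℝ) * L + iheight 𝔭 1 + (ideg 𝔭 1 : ℝ) * Real.log ((ideg 𝔭 1 : ℝ) + 2) +
          Real.sqrt ((ideg 𝔭 1 : ℝ) *
            (iheight 𝔭 1 + ideg 𝔭 1 + (ideg 𝔮 2 : ℝ) * Real.log ((ideg 𝔭 1 : ℝ) + 2)) * L))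

/-! ## P3: the height of a satellite carrying a long orbit -/

/-- **P3 `SatelliteHeightLine`** — a rational LINE `V(𝔩)` (`𝔩` prime of rank `2`, `deg 𝔩 = 1`)
carrying an orbit of `D ≥ 2` points has `h(𝔩) ≤ C (h(𝔭)/D + 1)` (absolute constant `C`): the
Chow form of the line is its Plücker bilinear form `σ₁b ∧ σ₂b`, `h(x ∧ y) ≤ h(x) + h(y) + log 2`,
conjugates are equi-high, and `h_K(b) ≤ h(𝔭) + cD` (dictionary (C)); the ABSOLUTE normalisation
`/D` is load-bearing. (Stub plan P3, k1 H7 / k2 H4b.) -/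
def SatelliteHeightLine : Prop :=
  ∃ C : ℝ, 0 < C ∧ ∀ (𝔭 𝔩 : Ideal (Rx 3)), 𝔭.IsPrime →
    𝔭.IsHomogeneous (homogeneousSubmodule (Fin (3 + 1)) ℚ) → IsUnmixedOfRank 𝔭 1 → 𝔩.IsPrime →
    𝔩.IsHomogeneous (homogeneousSubmodule (Fin (3 + 1)) ℚ) → IsUnmixedOfRank 𝔩 2 → ideg 𝔩 2 = 1 →
    𝔩 ≤ 𝔭 → 2 ≤ ideg 𝔭 1 →
    iheight 𝔩 2 ≤ C * (iheight 𝔭 1 / ideg 𝔭 1 + 1)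

/-- **P3′ `SatelliteHeight`** — general degree `δ`: a `ℚ`-curve `V(𝔮)` of degree `δ` carrying an
orbit of `D > 2δ²` points has `h(𝔮) ≤ C(δ) (h(𝔭)/D + 1)` (the degree-`2δ` part of `𝔮` is cut
out by the orbit, the `ℚ`-subspace `𝔮_{2δ}` has height `≲ δ³ h̄` by Hadamard on independent
evaluation rows, its Cramer spanning vectors are integer forms of that height, and Props 4.8/4.11/4.7
bound `h(𝔮)`). (Stub plan P3′, Tier 2.) -/
def SatelliteHeight : Prop :=
  ∀ δ : ℕ, 1 ≤ δ → ∃ C : ℝ, 0 < C ∧ ∀ (𝔭 𝔮 : Ideal (Rx 3)), 𝔭.IsPrime →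
    𝔭.IsHomogeneous (homogeneousSubmodule (Fin (3 + 1)) ℚ) → IsUnmixedOfRank 𝔭 1 → 𝔮.IsPrime →
    𝔮.IsHomogeneous (homogeneousSubmodule (Fin (3 + 1)) ℚ) → IsUnmixedOfRank 𝔮 2 → ideg 𝔮 2 = δ →
    𝔮 ≤ 𝔭 → 2 * δ ^ 2 < ideg 𝔭 1 →
    iheight 𝔮 2 ≤ C * (iheight 𝔭 1 / ideg 𝔭 1 + 1)

/-! ## P4: restart on a close container, directly in `ℙ³` -/

/-- **P4 `ContainerRestart`** — a `ℚ`-curve `V(𝔮)` on the complete intersection `(Q, R)`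
(`(Q)` prime of degree `a`, `R ∉ (Q)` of degree `b`, `a + b ≤ 3Δ`) passing within
`exp(−C(Δ/c + 1)(Δ h(𝔮) + Y deg 𝔮))` of `ω̄` is re-cut in degree `4⌊Δ⌋` by a small form
`F ∉ 𝔮` (landed `boxPrinciple_modIdeal` over `≥ ⌊Δ⌋ deg 𝔮` standard monomials, landed
`curveHilbert_lowerBound`; the container's own value by LNM 1752 Ch. 3 Cor. 4.10) and a small prime
orbit `𝔯 ⊇ 𝔮` is selected (landed `small_prime_of_cut`, `r = 2`, weights `(Δ, Y)`):
`deg 𝔯 ≤ 4Δ deg 𝔮`, `h(𝔯) ≤ C(Δ h(𝔮) + Y deg 𝔮)`, accuracy at constant `c`, `C = C(ω)`.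
(Stub plan P4, k1 H4 restated for `a + b ≤ 3Δ`.) -/
def ContainerRestart : Prop :=
  ∀ ω : Fin 3 → ℂ, ∃ C : ℝ, 1 ≤ C ∧
    ∀ (Q R : Rx 3) (a b : ℕ) (𝔮 : Ideal (Rx 3)),
      Q ≠ 0 → Q.IsHomogeneous a → R.IsHomogeneous b → 1 ≤ a → 1 ≤ b →
      (Ideal.span {Q}).IsPrime → R ∉ Ideal.span {Q} →
      𝔮.IsPrime → 𝔮.IsHomogeneous (homogeneousSubmodule (Fin (3 + 1)) ℚ) → IsUnmixedOfRank 𝔮 2 →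
      Q ∈ 𝔮 → R ∈ 𝔮 →
    ∀ (c Δ Y : ℝ), C ≤ c → c ≤ Δ → Δ ≤ Y → (a : ℝ) + b ≤ 3 * Δ →
      rho (Fin.cons 1 ω) 𝔮 ≤ Real.exp (-(C * (Δ / c + 1) * (Δ * iheight 𝔮 2 + Y * ideg 𝔮 2))) →
      ∃ 𝔯 : Ideal (Rx 3), 𝔯.IsPrime ∧ 𝔯.IsHomogeneous (homogeneousSubmodule (Fin (3 + 1)) ℚ) ∧
        IsUnmixedOfRank 𝔯 1 ∧ 𝔮 ≤ 𝔯 ∧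
        (ideg 𝔯 1 : ℝ) ≤ 4 * Δ * ideg 𝔮 2 ∧
        iheight 𝔯 1 ≤ C * (Δ * iheight 𝔮 2 + Y * ideg 𝔮 2) ∧
        iabs 𝔯 1 (Fin.cons 1 ω) ≤ Real.exp (-((Δ * iheight 𝔯 1 + Y * ideg 𝔯 1) / c))

/-! ## P7: satellite restart (two constants) -/

/-- **P7 `SatelliteRestart δ⋆`** — two constants, explicitly: for every descent constant `c ≥ 1`
there is a certification constant `c' ≥ c` such that a `c`-qualifying prime orbit `𝔭` TOO LONG for
the automatic clause at `c'` (`⌊c'Δ⌋ + 1 < deg 𝔭`) lying on a satellite `V(𝔮)` of the c.i.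
`(Q, R)` (`a + b ≤ 3Δ`) of degree `≤ δ⋆` is REPLACED by a cycle meeting the whole `CycleAPIAt 3`
conclusion at constant `c'`. (Composed from `OrbitFloor`, `SatelliteHeight[Line]`,
`ContainerRestart` and the landed `rankOne_interpolation_of_ideg_le`; stub plan P7, k2's
`LineRestart` shape.) -/
def SatelliteRestart (δstar : ℕ) : Prop :=
  ∀ ω : Fin 3 → ℂ, ∀ c : ℝ, 1 ≤ c → ∃ c' : ℝ, c ≤ c' ∧ ∀ Δ Y : ℝ, c' ≤ Δ → Δ ≤ Y →
    ∀ (Q R : Rx 3) (a b : ℕ) (𝔮 𝔭 : Ideal (Rx 3)),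
      Q ≠ 0 → Q.IsHomogeneous a → R.IsHomogeneous b → 1 ≤ a → 1 ≤ b → (a : ℝ) + b ≤ 3 * Δ →
      (Ideal.span {Q}).IsPrime → R ∉ Ideal.span {Q} →
      𝔮.IsPrime → 𝔮.IsHomogeneous (homogeneousSubmodule (Fin (3 + 1)) ℚ) → IsUnmixedOfRank 𝔮 2 →
      Q ∈ 𝔮 → R ∈ 𝔮 → ideg 𝔮 2 ≤ δstar →
      𝔭.IsPrime → 𝔭.IsHomogeneous (homogeneousSubmodule (Fin (3 + 1)) ℚ) → IsUnmixedOfRank 𝔭 1 →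
      𝔮 ≤ 𝔭 → ⌊c' * Δ⌋₊ + 1 < ideg 𝔭 1 →
      (ideg 𝔭 1 : ℝ) ≤ (c * Δ) ^ 3 → iheight 𝔭 1 ≤ c * Y * Δ ^ 2 →
      iabs 𝔭 1 (Fin.cons 1 ω) ≤ Real.exp (-((Δ * iheight 𝔭 1 + Y * ideg 𝔭 1) / c)) →
      ∃ I : Ideal (Rx 3), I.IsHomogeneous (homogeneousSubmodule (Fin (3 + 1)) ℚ) ∧
        IsUnmixedOfRank I 1 ∧
        (ideg I 1 : ℝ) ≤ (c' * Δ) ^ 3 ∧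
        iheight I 1 ≤ c' * Y * Δ ^ 2 ∧
        iabs I 1 (Fin.cons 1 ω) ≤ Real.exp (-((Δ * iheight I 1 + Y * ideg I 1) / c')) ∧
        ∀ 𝔯 ∈ I.associatedPrimes,
          Module.finrank ℚ ↥(homogeneousSubmodule (Fin (3 + 1)) ℚ ⌊c' * Δ⌋₊) =
            Module.finrank ℚ ↥(homogeneousSubmodule (Fin (3 + 1)) ℚ ⌊c' * Δ⌋₊ ⊓ 𝔯.restrictScalars ℚ) +
              ideg 𝔯 1

/-! ## P6: the residual (OPEN; disprover / strategist target) -/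

/-- **P6 `NoFarBadSatellite δ⋆`** — "far satellites are never BAD", stated on the whole descent
datum: for every descent constant `c ≥ 1` there is `c' ≥ c` such that whenever the selected orbit
`𝔭` of a `CycleAP3Datum` at `(c, Δ, Y)`, `Y ≥ Δ ≥ c'`, is too long for the automatic clause at `c'`
(`⌊c'Δ⌋ + 1 < deg 𝔭`) and lies on a satellite `𝔮'` — a homogeneous rank-`2` minimal prime of the
c.i. `(Q, P)` containing the third cut `T`, `𝔮' ≤ 𝔭` — of degree `> δ⋆`, the zeros of `𝔭` DO
impose independent conditions on the forms of degree `⌊c'Δ⌋`. OPEN (no seat has an argument; a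
failure needs the satellite to be a negative curve on the Noether–Lefschetz-special surface `V(Q)`,
cut out by `P` with multiplicity `≳ c'Δ/a`; the point extraction for such an orbit is Philippon's
AP2 at `n = 3`, LNM 1752 Ch. 4 §4 p. 61). NOT implied by the stub: it is the residual of this plan
only. (Stub plan P6 = k1 (C) = k2 (R) = k3 hole X = lead c2 branch β.) -/
def NoFarBadSatellite (δstar : ℕ) : Prop :=
  ∀ ω : Fin 3 → ℂ, ∀ c : ℝ, 1 ≤ c → ∃ c' : ℝ, c ≤ c' ∧ ∀ Δ Y : ℝ, c' ≤ Δ → Δ ≤ Y →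
    ∀ (Q : Rx 3) (a : ℕ) (P : Rx 3) (b : ℕ) (𝔮₂ : Ideal (Rx 3)) (T : Rx 3) (τ : ℕ)
      (𝔭 𝔮' : Ideal (Rx 3)),
      CycleAP3Datum ω c Δ Y Q a P b 𝔮₂ T τ 𝔭 →
      𝔮'.IsPrime → 𝔮'.IsHomogeneous (homogeneousSubmodule (Fin (3 + 1)) ℚ) → IsUnmixedOfRank 𝔮' 2 →
      𝔮' ∈ (Ideal.span {Q} ⊔ Ideal.span {P}).minimalPrimes → T ∈ 𝔮' → 𝔮' ≤ 𝔭 →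
      δstar < ideg 𝔮' 2 → ⌊c' * Δ⌋₊ + 1 < ideg 𝔭 1 →
      Module.finrank ℚ ↥(homogeneousSubmodule (Fin (3 + 1)) ℚ ⌊c' * Δ⌋₊) =
        Module.finrank ℚ ↥(homogeneousSubmodule (Fin (3 + 1)) ℚ ⌊c' * Δ⌋₊ ⊓ 𝔭.restrictScalars ℚ) +
          ideg 𝔭 1

/-! ## P5 (specialised): isolated points of three forms impose independent conditions -/

/-- **`IsolatedPointClause3`** — the good case of the plan as an intermediate statement: a prime
orbit `𝔭 ⊂ ℚ[x₀, …, x₃]` (rank `1`) which is a MINIMAL prime of `(Q, P, T)`, forms of degrees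
`a, b, τ ≤ δ₀` (so `V(𝔭)` is a Galois orbit of isolated points of the triple intersection),
imposes independent conditions on the forms of every degree `ν ≥ 3(δ₀ − 1) + 1` (written
`3δ₀ ≤ ν + 2`, no truncated subtraction). This is the
dimension-`0` case of Chardin–Philippon's regularity theorem (the isolated part of a scheme cut out
by forms of degrees `d₁ ≥ ⋯` has regularity `≤ d₁ + ⋯ + d_m − m + 1` in `ℙᵐ`, here on the safe
side `3δ₀ − 2`), specialised to three forms; it is to be discharged from that Literature fact once
the text (with its 2002 erratum) is held, and is an explicit hypothesis of the assembly meanwhile.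
(Stub plan P5.) -/
def IsolatedPointClause3 : Prop :=
  ∀ (Q P T : Rx 3) (a b τ δ₀ : ℕ), Q.IsHomogeneous a → P.IsHomogeneous b → T.IsHomogeneous τ →
    1 ≤ a → 1 ≤ b → 1 ≤ τ → a ≤ δ₀ → b ≤ δ₀ → τ ≤ δ₀ →
    ∀ 𝔭 : Ideal (Rx 3), 𝔭.IsPrime → 𝔭.IsHomogeneous (homogeneousSubmodule (Fin (3 + 1)) ℚ) →
      IsUnmixedOfRank 𝔭 1 → 𝔭 ∈ (Ideal.span {Q} ⊔ Ideal.span {P} ⊔ Ideal.span {T}).minimalPrimes →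
      ∀ ν : ℕ, 3 * δ₀ ≤ ν + 2 →
        Module.finrank ℚ ↥(homogeneousSubmodule (Fin (3 + 1)) ℚ ν) =
          Module.finrank ℚ ↥(homogeneousSubmodule (Fin (3 + 1)) ℚ ν ⊓ 𝔭.restrictScalars ℚ) +
            ideg 𝔭 1

/-! ## Sanity link (registered sub-goal): the datum forgets to the lead's clause-free descent -/

/-- **Registered sub-goal `cycleAP3Prime_of_data`**: forgetting the construction data, `CycleAP3Data`
gives the lead's registered clause-free descent `CycleAP3Prime` (its signature verbatim as the
consequent) — P1 is an enrichment, not a different statement. Pure bookkeeping. -/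
theorem cycleAP3Prime_of_data : CycleAP3Data → ∀ ω : Fin 3 → ℂ, ∃ c : ℝ, 1 ≤ c ∧ ∀ Δ Y : ℝ, c ≤ Δ → Δ ≤ Y → ∃ 𝔭 : Ideal (Rx 3), 𝔭.IsPrime ∧ 𝔭.IsHomogeneous (homogeneousSubmodule (Fin (3 + 1)) ℚ) ∧ IsUnmixedOfRank 𝔭 1 ∧ (ideg 𝔭 1 : ℝ) ≤ (c * Δ) ^ 3 ∧ iheight 𝔭 1 ≤ c * Y * Δ ^ 2 ∧ iabs 𝔭 1 (Fin.cons 1 ω) ≤ Real.exp (-((Δ * iheight 𝔭 1 + Y * ideg 𝔭 1) / c)) := by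
  intro hData ω
  obtain ⟨c, hc, h⟩ := hData ω
  refine ⟨c, hc, fun Δ Y hΔ hY => ?_⟩
  obtain ⟨Q, a, P, b, 𝔮₂, T, τ, 𝔭, hd⟩ := h Δ Y hΔ hY
  exact ⟨𝔭, hd.2.2.2.2.2.2.2.2.2.2.2.2.2.2.2.2.2.2.2.2.2.1,
    hd.2.2.2.2.2.2.2.2.2.2.2.2.2.2.2.2.2.2.2.2.2.2.1,
    hd.2.2.2.2.2.2.2.2.2.2.2.2.2.2.2.2.2.2.2.2.2.2.2.1,
    hd.2.2.2.2.2.2.2.2.2.2.2.2.2.2.2.2.2.2.2.2.2.2.2.2.2.2.2.1,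
    hd.2.2.2.2.2.2.2.2.2.2.2.2.2.2.2.2.2.2.2.2.2.2.2.2.2.2.2.2.1,
    hd.2.2.2.2.2.2.2.2.2.2.2.2.2.2.2.2.2.2.2.2.2.2.2.2.2.2.2.2.2⟩

end Summit.Schanuel.Schanuel.Cruxes.ApproximationProperty.OrbitInterpolationDeterminant

end
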